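import Summits.QuantumFields.GaugeBoot.DiagonalRPTorusInnerHalfNegativeHighDimMain
import Summits.QuantumFields.GaugeBoot.DiagonalRPTorusUniformEstimate
import HarnessLib

/-!
# Inner-half diagonal RP fails on the even tori `(ℤ/L)^d`, `d ≥ 4`, in a coupling window UNIFORM in `L` (gauge-boot, L3 uniform window, 4/6)

HONEST FRAMING (cell `pub-gaugeboot`, page 1 of every file): the venture produces certified bounds
on lattice expectations at stated coupling, gauge group, dimension and torus size; NOT a mass gap,
NOT a continuum limit, NOT a string tension; NOT Yang–Mills-summit-bearing (barriers
`FixedCouplingUltralocality`, `PerturbativeInvisibility`). This module is a structural NEGATIVE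
result about which positivity constraints a TORUS certificate may use; it discharges nothing else.

## Content (torus `(ℤ/L)^d`, `i < j < k < l` so `d ≥ 4`, every EVEN `L ≥ 4`)

`DiagonalRPTorusInnerHalfNegativeHighDimMain` proves: for `G ≅ SU(N)` (`N ≥ 2`) or `U(N)`
(`N ≥ 1`), inner-half diagonal RP (`InnerDiagonalRP ρ β i j`, mirror `x_i = x_j`) fails on every
even torus `(ℤ/L)^d`, `d ≥ 4`, `L ≥ 4`, for `0 < β ≤ β₀(L, N, d)` — the window came from the crude
tail bound `2^{#rest plaquettes}` and shrank to zero with `L`. THIS FILE REMOVES THE DEPENDENCE ON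
`L`: the same witness (the transverse plaquette pair `p = sq k l y₀`, `p̃ = sq k l x₁` of the top
inner layer, dressed by the half-action trick) has a negative RP form for ALL `0 < β ≤ β₀(N, d, c₁)`
SIMULTANEOUSLY ON EVERY EVEN TORUS `L ≥ 4`:

* **`trickForm_witness_neg_of_window`** — for `144 d² N β ≤ 1`, `2⁹ N¹⁰ β ≤ c₁⁹`,
  `3960 · 144⁹ d¹⁸ N¹⁰ β ≤ c₁⁹` (and `β > 0`) the trick form is `< 0`, whatever `L = 2c ≥ 4`;
* **`not_innerDiagonalRP_even_highDim_uniform_of_moments`** — `∃ β₀ > 0, ∀ L even ≥ 4,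
  ∀ 0 < β ≤ β₀, ¬ InnerDiagonalRP (d := d) (L := L) ρ β i j` (compact metrisable `G`, continuous
  `ρ` with a centre element `ρ z₀ = ω • 1`, `ω ≠ 1`, and (R1) with `c₁ > 0`);
  **`_specialUnitary`** (`N ≥ 2`), **`_unitary`** (`N ≥ 1`), and the concrete
  **`not_innerDiagonalRP_even_suN_highDim_uniform`** / **`_uN_highDim_uniform`** (`d ≥ 4`,
  mirror `x₀ = x₁`).

MECHANISM (`DiagonalRPTorusUniformEstimate`): in the back expansion `Σ_{Q ⊆ rest} combo(Q)` the
plaquettes of `Q` not connected (through shared links) to the four observable squares are RESUMMED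
into positive partial partition functions, whose ratios cost `e^{±βN}` per switched plaquette; what
remains is a sum over seed-connected clusters, controlled by the tree's Peierls–Kotecký–Preiss
entropy bound with `L`-independent degree (`8d²`) and seed (`32d²`) counts; the two tubes give
`-2 · β⁸ c₁⁹ N (1 + O(β))`, everything else `O(β⁹)` with constants depending on `N, d` only.
MEANING (one sentence): for the venture's gauge groups, inner-half diagonal RP on `(ℤ/L)^d`, `d ≥ 4`,
cannot be rescued by taking the torus large at fixed small coupling. `β₀` is explicit but absurdly
small (`~ c₁⁹ / (10¹⁹·4 d¹⁸ N¹⁰)`); no attempt at optimising it. Elementary strong-coupling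
expansion (Osterwalder–Seiler 1978 §3 polymer bookkeeping); not in print as far as the cell's
searches go (printed precedent for the phenomenon in spin systems: FILS, J. Stat. Phys. 22 (1980)
297, §3; Biskup, LNM 1970 (2009) §5.5).
-/

open MeasureTheory Finset Function
open scoped ComplexOrder

namespace Summit.QuantumFields.GaugeBoot

open Literature.MathematicalPhysics.QuantumFieldTheory
open Literature.MathematicalPhysics.QuantumFieldTheory.PlaquetteLowerBound (reTr)
open Literature.RepresentationTheory.CompactGroups

noncomputable section

namespace DiagRPUnif

open DiagRPTube

/-! ## The estimate at fixed `L`, with `L`-independent conditions on `β` -/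

section Estimate

variable {d L : ℕ} [NeZero L] {N : ℕ} {G : Type*} [Group G] [TopologicalSpace G]
  [IsTopologicalGroup G] [CompactSpace G] [MeasurableSpace G] [BorelSpace G]
  [SecondCountableTopology G] (ρ : G →* Matrix (Fin N) (Fin N) ℂ)
  {i j k l : Fin d} (hij : i < j) (hjk : j < k) (hkl : k < l) {c : ℕ} (hc : 2 ≤ c) (hL : L = 2 * c)
  (hρ : Continuous ρ) {z₀ : G} {ω : ℂ} (hz₀ : ρ z₀ = ω • (1 : Matrix (Fin N) (Fin N) ℂ))
  (hω : ω ≠ 1) {c₁ : ℝ}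
  (hR1 : ∀ x y : G, ∫ g, reTr ρ (x * g⁻¹) * reTr ρ (g * y) ∂haarProbability G = c₁ * reTr ρ (x * y))

include hij hjk hkl hc hL hρ hz₀ hω hR1
/-- ★ **THE WINDOW ESTIMATE (even `L`, `d ≥ 4`).** For `β > 0` with `144 d² N β ≤ 1`,
`2⁹ N¹⁰ β ≤ c₁⁹` and `3960 · 144⁹ d¹⁸ N¹⁰ β ≤ c₁⁹` — conditions that do not mention `L` — the
trick form of the witness `Re tr ρ(U_p) - Re tr ρ(U_{p̃})` is NEGATIVE on `(ℤ/L)^d`, `L = 2c ≥ 4`. -/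
theorem trickForm_witness_neg_of_window (hN : 1 ≤ N) (hc₁ : 0 < c₁) {β : ℝ} (hβ : 0 < β)
    (hβ2 : 144 * (d : ℝ) ^ 2 * N * β ≤ 1) (hβ3 : 2 ^ 9 * (N : ℝ) ^ 10 * β ≤ c₁ ^ 9)
    (hβ4 : 3960 * 144 ^ 9 * (d : ℝ) ^ 18 * N ^ 10 * β ≤ c₁ ^ 9) :
    trickForm ρ i j c β (fun U => WilsonRP.plaqRe ρ U (sq k l hkl (baseLow (L := L) i c)) -
        WilsonRP.plaqRe ρ U (sq k l hkl (baseLow' (L := L) i j c))) < 0 := by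
  have hL3 : 3 ≤ L := by omega
  have hd : 1 ≤ d := Fin.pos i
  have hd' : (1 : ℝ) ≤ d := by exact_mod_cast hd
  have hNr : (1 : ℝ) ≤ N := by exact_mod_cast hN
  have hik : i < k := hij.trans hjk
  have hil : i < l := hij.trans (hjk.trans hkl)
  have hjl : j < l := hjk.trans hkl
  have hβN0 : 0 ≤ β * N := by positivity
  have hd2 : (1 : ℝ) ≤ (d : ℝ) ^ 2 := by nlinarith
  have hX : β * N ≤ (d : ℝ) ^ 2 * (β * N) := le_mul_of_one_le_left hβN0 hd2
  have hX0 : 0 ≤ (d : ℝ) ^ 2 * (β * N) := by positivity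
  have e144 : 144 * (d : ℝ) ^ 2 * N * β = 144 * ((d : ℝ) ^ 2 * (β * N)) := by ring
  have hβN1 : β * N ≤ 1 := by linarith
  set y₀ : Site d L := baseLow (L := L) i c with hy₀
  set x₁ : Site d L := baseLow' (L := L) i j c with hx₁
  set w₀ : Site d L := siteDiagSwap i j y₀ with hw₀
  set w₁ : Site d L := siteDiagSwap i j x₁ with hw₁
  have hly₀ : lay i j y₀ = ((c - 1 : ℕ) : ZMod L) := lay_baseLow hij
  have hlx₁ : lay i j x₁ = ((c - 1 : ℕ) : ZMod L) := lay_baseLow' hij hc hL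
  have hlw₀ : lay i j w₀ = -((c - 1 : ℕ) : ZMod L) := lay_swap_baseLow hij
  have hlw₁ : lay i j w₁ = -((c - 1 : ℕ) : ZMod L) := lay_swap_baseLow' hij hc hL
  have hw₀x : w₀ = (x₁.shift i).shift i := swap_baseLow hij
  have hw₁y : w₁ = dn (dn y₀ j) j := swap_baseLow' hij
  have hy : (w₁.shift j).shift j = y₀ := by rw [hw₁y, dn_shift, dn_shift]
  -- the expansion
  rw [trickForm_plaqDiff_eq_sum ρ β hρ, plaqSwap_sq hij hjk hkl, plaqSwap_sq hij hjk hkl, ← hw₀, ← hw₁]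
  set R := restPlaqs (L := L) i j c with hR
  -- the two tubes
  have hM₁R : tubeSet hik hil x₁ ⊆ R := tubeSet_i_subset hij hjk hkl hc hL hlx₁
  have hM₂R : tubeSet hjk hjl w₁ ⊆ R := by rw [hw₁y]; exact tubeSet_j_subset hij hjk hkl hc hL hly₀
  have hM₁K : ∀ q ∈ tubeSet hik hil x₁,
      Touch (seedLinks (sq k l hkl w₀) (sq k l hkl w₁) (sq k l hkl y₀) (sq k l hkl x₁)) q := by
    intro q hq
    unfold tubeSet at hq
    rcases mem_union.1 hq with h | h
    · obtain ⟨a, -, rfl⟩ := mem_image.1 h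
      have h' := hasLink_ring_low hik hil hkl x₁ a
      exact touch_iff.2 ⟨_, plinks_v₂_subset _ _ _ _ (link_mem_plinks _ a), h'⟩
    · obtain ⟨a, -, rfl⟩ := mem_image.1 h
      have h' := hasLink_ring_high hik hil hkl (x₁.shift i) a
      rw [← hw₀x] at h'
      exact touch_iff.2 ⟨_, plinks_u₁_subset _ _ _ _ (link_mem_plinks _ a), h'⟩
  have hM₂K : ∀ q ∈ tubeSet hjk hjl w₁,
      Touch (seedLinks (sq k l hkl w₀) (sq k l hkl w₁) (sq k l hkl y₀) (sq k l hkl x₁)) q := by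
    intro q hq
    unfold tubeSet at hq
    rcases mem_union.1 hq with h | h
    · obtain ⟨a, -, rfl⟩ := mem_image.1 h
      have h' := hasLink_ring_low hjk hjl hkl w₁ a
      exact touch_iff.2 ⟨_, plinks_u₂_subset _ _ _ _ (link_mem_plinks _ a), h'⟩
    · obtain ⟨a, -, rfl⟩ := mem_image.1 h
      have h' := hasLink_ring_high hjk hjl hkl (w₁.shift j) a
      rw [hy] at h'
      exact touch_iff.2 ⟨_, plinks_v₁_subset _ _ _ _ (link_mem_plinks _ a), h'⟩
  have hM₁n : (tubeSet hik hil x₁).card ≤ 8 := (card_tubeSet hik hil hkl hL3 x₁).le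
  have hM₂n : (tubeSet hjk hjl w₁).card ≤ 8 := (card_tubeSet hjk hjl hkl hL3 w₁).le
  -- the shape theorem: small terms
  obtain ⟨a1, a2, a3, a4⟩ := offsets_pp (L := L) hij hc hL
  obtain ⟨b1, b2, b3, b4⟩ := offsets_pp' (L := L) hij hc hL
  have h11 : ∀ Q ⊆ R, Q.card ≤ 8 → pairT ρ β Q (sq k l hkl w₀) (sq k l hkl y₀) = 0 :=
    fun Q hQR hcard =>
      pairT_eq_zero_of_ne_offsets hij hjk hkl hc hL hρ hz₀ hω hly₀ hlw₀ a1 a2 a3 a4 hQR hcard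
  have h22 : ∀ Q ⊆ R, Q.card ≤ 8 → pairT ρ β Q (sq k l hkl w₁) (sq k l hkl x₁) = 0 :=
    fun Q hQR hcard =>
      pairT_eq_zero_of_ne_offsets hij hjk hkl hc hL hρ hz₀ hω hlx₁ hlw₁ b1 b2 b3 b4 hQR hcard
  have h12 : ∀ Q ⊆ R, Q.card ≤ 8 → pairT ρ β Q (sq k l hkl w₀) (sq k l hkl x₁) ≠ 0 →
      Q = tubeSet hik hil x₁ := fun Q hQR hcard hT0 =>
    eq_tubeI_of_pairT_ne_zero hij hjk hkl hc hL hρ hz₀ hω hlx₁ hlw₀ hw₀x hQR hcard hT0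
  have h21 : ∀ Q ⊆ R, Q.card ≤ 8 → pairT ρ β Q (sq k l hkl w₁) (sq k l hkl y₀) ≠ 0 →
      Q = tubeSet hjk hjl w₁ := by
    intro Q hQR hcard hT0
    rw [eq_tubeJ_of_pairT_ne_zero hij hjk hkl hc hL hρ hz₀ hω hly₀ hlw₁ hw₁y hQR hcard hT0,
      tubeSet, union_comm, hw₁y, dn_shift]
  -- the tube values
  have hmle : β ^ 8 * (c₁ ^ 9 * N) / 2 ≤ β ^ 8 * (c₁ ^ 9 * N) - N ^ 2 * (2 ^ 8 * (β * N) ^ 9) := by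
    have h := mul_le_mul_of_nonneg_right hβ3 (by positivity : (0 : ℝ) ≤ β ^ 8 * N)
    have e1 : (N : ℝ) ^ 2 * (2 ^ 8 * (β * N) ^ 9) = 2 ^ 9 * (N : ℝ) ^ 10 * β * (β ^ 8 * N) / 2 := by
      ring
    have e2 : β ^ 8 * (c₁ ^ 9 * N) = c₁ ^ 9 * (β ^ 8 * N) := by ring
    rw [e1, e2]
    linarith
  have hm₁ : β ^ 8 * (c₁ ^ 9 * N) / 2 ≤ pairT ρ β (tubeSet hik hil x₁) (sq k l hkl w₀) (sq k l hkl x₁) := by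
    have h := pairT_tubeSet_ge ρ hik hil hkl hL3 hρ hR1 hβ.le hβN1 x₁
    rw [← hw₀x] at h
    exact hmle.trans h
  have hm₂ : β ^ 8 * (c₁ ^ 9 * N) / 2 ≤ pairT ρ β (tubeSet hjk hjl w₁) (sq k l hkl w₁) (sq k l hkl y₀) := by
    rw [pairT_comm]
    have h := pairT_tubeSet_ge ρ hjk hjl hkl hL3 hρ hR1 hβ.le hβN1 w₁
    rw [hy] at h
    exact hmle.trans h
  -- the window
  have hβ1 : (32 + 8 * ((8 : ℕ) : ℝ)) * (d : ℝ) ^ 2 * N * β ≤ 1 := by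
    have e : (32 + 8 * ((8 : ℕ) : ℝ)) * (d : ℝ) ^ 2 * N * β = 96 * ((d : ℝ) ^ 2 * (β * N)) := by
      push_cast; ring
    linarith
  have hwin : 660 * (N : ℝ) ^ 2 * (144 * (d : ℝ) ^ 2 * N * β) ^ (8 + 1) <
      2 / 3 * (β ^ 8 * (c₁ ^ 9 * N) / 2) := by
    have hlt : 1980 * 144 ^ 9 * (d : ℝ) ^ 18 * N ^ 10 * β < c₁ ^ 9 := by
      have : (0 : ℝ) < c₁ ^ 9 := by positivity
      linarith
    have h := mul_lt_mul_of_pos_right hlt (by positivity : (0 : ℝ) < β ^ 8 * N)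
    have e1 : 660 * (N : ℝ) ^ 2 * (144 * (d : ℝ) ^ 2 * N * β) ^ (8 + 1) =
        1980 * 144 ^ 9 * (d : ℝ) ^ 18 * N ^ 10 * β * (β ^ 8 * N) / 3 := by ring
    have e2 : 2 / 3 * (β ^ 8 * (c₁ ^ 9 * N) / 2) = c₁ ^ 9 * (β ^ 8 * N) / 3 := by ring
    rw [e1, e2]
    linarith
  have h := sum_combo_neg ρ β (u₁ := sq k l hkl w₀) (u₂ := sq k l hkl w₁) (v₁ := sq k l hkl y₀)
    (v₂ := sq k l hkl x₁) (R := R) hρ hβ.le hβN1 hM₁R hM₂R hM₁K hM₂K hM₁n hM₂n h11 h22 h12 h21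
    (by positivity) hm₁ hm₂ hd hβ1 hβ2 hwin
  simpa only [combo] using h

end Estimate

/-! ## The uniform theorem -/

section Main

variable {d : ℕ} {N : ℕ} {G : Type*} [Group G] [TopologicalSpace G]
  [IsTopologicalGroup G] [CompactSpace G] [MeasurableSpace G] [BorelSpace G]
  [SecondCountableTopology G] (ρ : G →* Matrix (Fin N) (Fin N) ℂ)
  {i j k l : Fin d} (hij : i < j) (hjk : j < k) (hkl : k < l)

include hij hjk hkl in
/-- ★ **Inner-half diagonal RP fails on every even torus `(ℤ/L)^d`, `d ≥ 4`, in a coupling window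
UNIFORM IN `L`, from the character moments.** Let `G` be compact metrisable, `ρ` continuous
(`N ≥ 1`) with a centre element `ρ z₀ = ω • 1`, `ω ≠ 1`, and with
(R1) `∫ Re χ(x g⁻¹) Re χ(g y) dg = c₁ Re χ(x y)`, `c₁ > 0`. Then for four directions
`i < j < k < l` there is ONE `β₀ = β₀(N, d, c₁) > 0` such that
`¬ InnerDiagonalRP (d := d) (L := L) ρ β i j` for EVERY even `L ≥ 4` and all `0 < β ≤ β₀`. -/
theorem not_innerDiagonalRP_even_highDim_uniform_of_moments (hρ : Continuous ρ) (hN : 1 ≤ N)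
    {z₀ : G} {ω : ℂ} (hz₀ : ρ z₀ = ω • (1 : Matrix (Fin N) (Fin N) ℂ)) (hω : ω ≠ 1) {c₁ : ℝ}
    (hc₁ : 0 < c₁)
    (hR1 : ∀ x y : G, ∫ g, reTr ρ (x * g⁻¹) * reTr ρ (g * y) ∂haarProbability G =
      c₁ * reTr ρ (x * y)) :
    ∃ β₀ : ℝ, 0 < β₀ ∧ ∀ (L : ℕ) [NeZero L], Even L → 4 ≤ L → ∀ β : ℝ, 0 < β → β ≤ β₀ →
      ¬ InnerDiagonalRP (d := d) (L := L) ρ β i j := by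
  have hd0 : (0 : ℝ) < d := by exact_mod_cast Fin.pos i
  have hN0 : (0 : ℝ) < N := by exact_mod_cast hN
  have hA : (0 : ℝ) < 144 * (d : ℝ) ^ 2 * N := by positivity
  have hB : (0 : ℝ) < 2 ^ 9 * (N : ℝ) ^ 10 := by positivity
  have hC : (0 : ℝ) < 3960 * 144 ^ 9 * (d : ℝ) ^ 18 * N ^ 10 := by positivity
  have hc9 : (0 : ℝ) < c₁ ^ 9 := by positivity
  refine ⟨min (1 / (144 * (d : ℝ) ^ 2 * N))
      (min (c₁ ^ 9 / (2 ^ 9 * (N : ℝ) ^ 10)) (c₁ ^ 9 / (3960 * 144 ^ 9 * (d : ℝ) ^ 18 * N ^ 10))),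
    lt_min (by positivity) (lt_min (by positivity) (by positivity)), ?_⟩
  intro L _ hLeven h4 β hβ hβ0
  obtain ⟨c, hcc⟩ := hLeven
  have hL : L = 2 * c := by omega
  have hc : 2 ≤ c := by omega
  have hL2 : L / 2 = c := by omega
  have h1 : β ≤ 1 / (144 * (d : ℝ) ^ 2 * N) := (le_min_iff.1 hβ0).1
  have h2 : β ≤ c₁ ^ 9 / (2 ^ 9 * (N : ℝ) ^ 10) := (le_min_iff.1 (le_min_iff.1 hβ0).2).1
  have h3 : β ≤ c₁ ^ 9 / (3960 * 144 ^ 9 * (d : ℝ) ^ 18 * N ^ 10) :=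
    (le_min_iff.1 (le_min_iff.1 hβ0).2).2
  rw [le_div_iff₀ hA] at h1
  rw [le_div_iff₀ hB] at h2
  rw [le_div_iff₀ hC] at h3
  have hβ2 : 144 * (d : ℝ) ^ 2 * N * β ≤ 1 := by linarith
  have hβ3 : 2 ^ 9 * (N : ℝ) ^ 10 * β ≤ c₁ ^ 9 := by linarith
  have hβ4 : 3960 * 144 ^ 9 * (d : ℝ) ^ 18 * N ^ 10 * β ≤ c₁ ^ 9 := by linarith
  have hneg : trickForm ρ i j (L / 2) β (fun U : GaugeConfig d L G =>
      WilsonRP.plaqRe ρ U (sq k l hkl (baseLow (L := L) i c)) -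
        WilsonRP.plaqRe ρ U (sq k l hkl (baseLow' (L := L) i j c))) < 0 := by
    rw [hL2]
    exact trickForm_witness_neg_of_window ρ hij hjk hkl hc hL hρ hz₀ hω hR1 hN hc₁ hβ hβ2 hβ3 hβ4
  exact not_innerDiagonalRP_of_trickForm_neg ρ hρ
    (((continuous_plaqRe ρ hρ _).sub (continuous_plaqRe ρ hρ _)))
    (isInnerHalfObservable_witness ρ hij hjk hkl hc hL) hneg

include hij hjk hkl in
/-- ★★ **Uniform window for `G ≅ SU(N)`** (`IsSpecialUnitaryModel ρ`, `N ≥ 2`): one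
`β₀ = β₀(N, d) > 0` for all even tori `L ≥ 4`. -/
theorem not_innerDiagonalRP_even_highDim_uniform_specialUnitary (hρ : IsSpecialUnitaryModel ρ)
    (hN : 2 ≤ N) :
    ∃ β₀ : ℝ, 0 < β₀ ∧ ∀ (L : ℕ) [NeZero L], Even L → 4 ≤ L → ∀ β : ℝ, 0 < β → β ≤ β₀ →
      ¬ InnerDiagonalRP (d := d) (L := L) ρ β i j := by
  obtain ⟨z₀, ω, hω, hz₀⟩ := DiagRPSUN.exists_smul_one ρ hρ hN
  obtain ⟨c₁, hc₁, hR1⟩ := DiagRPSUN.exists_re_conv_const ρ hρ hN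
  exact not_innerDiagonalRP_even_highDim_uniform_of_moments ρ hij hjk hkl hρ.1 (by omega)
    hz₀ hω hc₁ hR1

include hij hjk hkl in
/-- ★★ **Uniform window for `G ≅ U(N)`** (`IsUnitaryModel ρ`, `N ≥ 1`): one `β₀ = β₀(N, d) > 0`
for all even tori `L ≥ 4`. -/
theorem not_innerDiagonalRP_even_highDim_uniform_unitary (hρ : IsUnitaryModel ρ) (hN : 1 ≤ N) :
    ∃ β₀ : ℝ, 0 < β₀ ∧ ∀ (L : ℕ) [NeZero L], Even L → 4 ≤ L → ∀ β : ℝ, 0 < β → β ≤ β₀ →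
      ¬ InnerDiagonalRP (d := d) (L := L) ρ β i j := by
  obtain ⟨z₀, ω, hω, hz₀⟩ := DiagRPSUN.exists_smul_one_unitary ρ hρ
  have hNpos : (0 : ℝ) < N := by exact_mod_cast hN
  exact not_innerDiagonalRP_even_highDim_uniform_of_moments ρ hij hjk hkl hρ.1 hN hz₀ hω
    (c₁ := (2 * N : ℝ)⁻¹) (by positivity) (DiagRPSUN.integral_re_trace_mul_inv_mul_unitary ρ hρ)

include hij hjk hkl in
/-- The back-gauge-invariant closed-half statement fails as well, uniformly in `L` (`G ≅ SU(N)`). -/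
theorem not_backInvariantDiagonalRP_even_highDim_uniform_specialUnitary
    (hρ : IsSpecialUnitaryModel ρ) (hN : 2 ≤ N) :
    ∃ β₀ : ℝ, 0 < β₀ ∧ ∀ (L : ℕ) [NeZero L], Even L → 4 ≤ L → ∀ β : ℝ, 0 < β → β ≤ β₀ →
      ¬ BackInvariantDiagonalRP (d := d) (L := L) ρ β i j := by
  obtain ⟨β₀, hβ₀, h⟩ :=
    not_innerDiagonalRP_even_highDim_uniform_specialUnitary ρ hij hjk hkl hρ hN
  exact ⟨β₀, hβ₀, fun L _ hLe h4 β hβ hβ1 hB => h L hLe h4 β hβ hβ1 hB.innerDiagonalRP⟩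

end Main

/-! ## The concrete groups on `(ℤ/L)^d`, `d ≥ 4`, mirror `x₀ = x₁` -/

section Concrete

open Literature.MathematicalPhysics.QuantumLattice

/-- ★★ **`SU(N)` lattice gauge theory (`N ≥ 2`) violates inner-half diagonal RP on EVERY even
torus `(ℤ/L)^d`, `d ≥ 4`, `L ≥ 4`, for ALL `0 < β ≤ β₀(N, d)`** — one coupling window for all torus
sizes (mirror `x₀ = x₁`; not vacuous). -/
theorem not_innerDiagonalRP_even_suN_highDim_uniform {d N : ℕ} (hd : 4 ≤ d) (hN : 2 ≤ N) :
    ∃ β₀ : ℝ, 0 < β₀ ∧ ∀ (L : ℕ) [NeZero L], Even L → 4 ≤ L → ∀ β : ℝ, 0 < β → β ≤ β₀ →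
      ¬ InnerDiagonalRP (d := d) (L := L) (fundamentalRep (Fin N)) β ⟨0, by omega⟩ ⟨1, by omega⟩ := by
  haveI : SecondCountableTopology (Matrix (Fin N) (Fin N) ℂ) :=
    inferInstanceAs (SecondCountableTopology (Fin N → Fin N → ℂ))
  haveI : SecondCountableTopology (Matrix.specialUnitaryGroup (Fin N) ℂ) :=
    Topology.IsEmbedding.subtypeVal.secondCountableTopology
  have h2 : 2 < d := by omega
  have h3 : 3 < d := by omega
  have hij : (⟨0, by omega⟩ : Fin d) < ⟨1, by omega⟩ := Fin.mk_lt_mk.2 (by norm_num)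
  have hjk : (⟨1, by omega⟩ : Fin d) < ⟨2, h2⟩ := Fin.mk_lt_mk.2 (by norm_num)
  have hkl : (⟨2, h2⟩ : Fin d) < ⟨3, h3⟩ := Fin.mk_lt_mk.2 (by norm_num)
  exact not_innerDiagonalRP_even_highDim_uniform_specialUnitary (fundamentalRep (Fin N)) hij hjk hkl
    (TorusAreaLaw.isSpecialUnitaryModel_fundamentalRep N) hN

/-- The back-gauge-invariant closed-half statement fails as well for `SU(N)`, uniformly in `L`. -/
theorem not_backInvariantDiagonalRP_even_suN_highDim_uniform {d N : ℕ} (hd : 4 ≤ d) (hN : 2 ≤ N) :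
    ∃ β₀ : ℝ, 0 < β₀ ∧ ∀ (L : ℕ) [NeZero L], Even L → 4 ≤ L → ∀ β : ℝ, 0 < β → β ≤ β₀ →
      ¬ BackInvariantDiagonalRP (d := d) (L := L) (fundamentalRep (Fin N)) β ⟨0, by omega⟩
        ⟨1, by omega⟩ := by
  obtain ⟨β₀, hβ₀, h⟩ := not_innerDiagonalRP_even_suN_highDim_uniform hd hN
  exact ⟨β₀, hβ₀, fun L _ hLe h4 β hβ hβ1 hB => h L hLe h4 β hβ hβ1 hB.innerDiagonalRP⟩

/-- ★★ **`U(N)` lattice gauge theory (`N ≥ 1`; `N = 1`: compact `U(1)`) violates inner-half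
diagonal RP on EVERY even torus `(ℤ/L)^d`, `d ≥ 4`, `L ≥ 4`, for ALL `0 < β ≤ β₀(N, d)`** (mirror
`x₀ = x₁`; not vacuous). -/
theorem not_innerDiagonalRP_even_uN_highDim_uniform {d N : ℕ} (hd : 4 ≤ d) (hN : 1 ≤ N) :
    ∃ β₀ : ℝ, 0 < β₀ ∧ ∀ (L : ℕ) [NeZero L], Even L → 4 ≤ L → ∀ β : ℝ, 0 < β → β ≤ β₀ →
      ¬ InnerDiagonalRP (d := d) (L := L) (unitaryFundamentalRep (Fin N) ℂ) β ⟨0, by omega⟩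
        ⟨1, by omega⟩ := by
  haveI : SecondCountableTopology (Matrix.unitaryGroup (Fin N) ℂ) :=
    IsUnitaryModel.secondCountableTopology _ (isUnitaryModel_unitaryFundamentalRep N)
  have h2 : 2 < d := by omega
  have h3 : 3 < d := by omega
  have hij : (⟨0, by omega⟩ : Fin d) < ⟨1, by omega⟩ := Fin.mk_lt_mk.2 (by norm_num)
  have hjk : (⟨1, by omega⟩ : Fin d) < ⟨2, h2⟩ := Fin.mk_lt_mk.2 (by norm_num)
  have hkl : (⟨2, h2⟩ : Fin d) < ⟨3, h3⟩ := Fin.mk_lt_mk.2 (by norm_num)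
  exact not_innerDiagonalRP_even_highDim_uniform_unitary (unitaryFundamentalRep (Fin N) ℂ) hij hjk hkl
    (isUnitaryModel_unitaryFundamentalRep N) hN

end Concrete

end DiagRPUnif

end

end Summit.QuantumFields.GaugeBoot
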